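import Summits.QuantumFields.GaugeBoot.StrongCouplingOrderSuN
import Summits.QuantumFields.GaugeBoot.BootstrapStrongCoupling
import HarnessLib

/-!
# `ℤ^d`: the infinite-volume word-truncated bootstrap is exact at `β = 0` and its level-`M` interval has width `O(β^q)` (gauge-boot, L1 supplement)

HONEST FRAMING (cell `pub-gaugeboot`, page 1 of every file): the venture produces certified bounds
on lattice expectations at stated coupling, gauge group, dimension and torus size; NOT a mass gap,
NOT a continuum limit, NOT a string tension; NOT Yang–Mills-summit-bearing (barriers
`FixedCouplingUltralocality`, `PerturbativeInvisibility`). Structural, qualitatively quantitative: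
constants are not computed and no number is certified.

## Content

`StrongCouplingOrder.lean` is lattice-agnostic; `StrongCouplingOrderSuN.lean` instantiated it on
the torus. This file supplies the INFINITE-VOLUME instance — the setting of Anderson–Kruczenski and
Kazakov–Zheng: unknowns are the values of local polynomial observables on `ℤ^d`, constraints the
one-link loop equations of the boundary Wilson actions `S_{e}` and positivity, truncated by word
length (`BootstrapConvergence.bootstrap_convergence_dlr_suN`).

* `haarPi ι G` — product Haar probability measure on `ι → G` for ANY index type (Mathlib
  `Measure.infinitePi`, in the import closure through the `ℤ^d` DLR files); `integral_haarPi_eq_of_mem_wordSpace` (a word observable on a finite link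
  set integrates over the finite product); ★ `integral_sderiv_haarPi_eq_zero` (its expectation
  functional satisfies the Schwinger–Dyson rows at `β = 0`: finite marginal + the tree's
  `eq_pi_tilted_iff_sd` at `β = 0`); ★ `eq_zero_of_integral_mul_self_haarPi_eq_zero` (faithful);
* `zdActionCM e` — the boundary Wilson action `S_{e}` as a word observable of degree `4` on the
  links of the plaquettes through `e` (`zdActionCM_mem_wordSpace`), `zdActionDeriv` its shift
  derivatives;
* ★★★ `exists_const_abs_sub_le_pow_zd_suN` — `SU(N)` on `ℤ^d`, every `d`, `N`, real `β`: for a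
  test function `P` of length `≤ n` and every `q` there is `C` with: any two functionals feasible
  for the level-`M` word-truncated infinite-volume bootstrap (`n + 4q ≤ M + 4`, `n + 4q ≤ 2M`) give
  `P` values differing by at most `C |β|^q`; ★★★ `apply_eq_haarPi_of_feasible_zero_zd_suN` — at
  `β = 0` every level-`M` feasible functional gives every test function of length `≤ M` its product
  Haar value.

NOT claimed: a rate at fixed `β`; anything about which DLR state the bootstrap approaches.
References: P. Anderson, M. Kruczenski, Nucl. Phys. B 921 (2017); V. Kazakov, Z. Zheng,
arXiv:2203.11360; Yu. Makeenko (2002) §12 Problem 12.7. Folklore mechanism; truncated statement new.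
-/

noncomputable section

open MeasureTheory Filter Topology NormedSpace
open Literature.MathematicalPhysics.QuantumFieldTheory (LatticeRep haarProbability)
open Literature.MathematicalPhysics.QuantumLattice

namespace Summit.QuantumFields.GaugeBoot

/-! ## Product Haar on any lattice: a faithful `β = 0` functional -/

section HaarPi

variable (ι : Type*) (G : Type*) [Group G] [TopologicalSpace G] [IsTopologicalGroup G]
  [CompactSpace G] [MeasurableSpace G] [BorelSpace G]

/-- **Product Haar probability measure** on `ι → G`, any index type (Mathlib `Measure.infinitePi`).
[folklore] -/
def haarPi : Measure (ι → G) := Measure.infinitePi fun _ : ι => haarProbability G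

/-- `haarPi` is a probability measure. -/
instance isProbabilityMeasure_haarPi : IsProbabilityMeasure (haarPi ι G) := by
  unfold haarPi; infer_instance

variable {ι G} [DecidableEq ι] (r : LatticeRep G)

omit [IsTopologicalGroup G] [CompactSpace G] [MeasurableSpace G] [BorelSpace G] in
/-- Extension by `1` off `S` is continuous. -/
theorem continuous_updateFinset_one (S : Finset ι) :
    Continuous fun y : ↥S → G => Function.updateFinset (1 : ι → G) S y := by
  refine continuous_pi fun j => ?_
  by_cases hj : j ∈ S
  · simp only [Function.updateFinset, dif_pos hj]
    exact continuous_apply _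
  · simp only [Function.updateFinset, dif_neg hj]
    exact continuous_const

omit [IsTopologicalGroup G] [CompactSpace G] [MeasurableSpace G] [BorelSpace G] in
/-- Extending a configuration of the links of `S` by `1` and restricting back. -/
theorem apply_updateFinset_restrict_of_mem_wordSpace {S : Finset ι} {n : ℕ} {f : C(ι → G, ℝ)}
    (hf : f ∈ wordSpace r (S : Set ι) n) (U : ι → G) :
    f (Function.updateFinset (1 : ι → G) S (S.restrict U)) = f U :=
  apply_eq_of_mem_wordSpace r hf fun i hi => by
    have hi' : i ∈ S := hi
    simp [Function.updateFinset, hi']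

omit [TopologicalSpace G] [IsTopologicalGroup G] [CompactSpace G] [MeasurableSpace G] [BorelSpace G] in
/-- Extension by `1` commutes with updating a link of `S`. -/
theorem updateFinset_update {S : Finset ι} (y : ↥S → G) {i : ι} (hi : i ∈ S) (g : G) :
    Function.updateFinset (1 : ι → G) S (Function.update y ⟨i, hi⟩ g) =
      Function.update (Function.updateFinset (1 : ι → G) S y) i g := by
  funext j
  by_cases hjS : j ∈ S
  · by_cases hj : j = i
    · subst hj
      simp [Function.updateFinset, hjS]
    · have hne : (⟨j, hjS⟩ : ↥S) ≠ ⟨i, hi⟩ := fun h => hj (congrArg Subtype.val h)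
      simp [Function.updateFinset, hjS, Function.update_of_ne hne, Function.update_of_ne hj]
  · have hj : j ≠ i := fun h => hjS (h ▸ hi)
    simp [Function.updateFinset, hjS, Function.update_of_ne hj]

variable [SecondCountableTopology G]

/-- ★ **A word observable on the finite link set `S` integrates over the finite product.** -/
theorem integral_haarPi_eq_of_mem_wordSpace {S : Finset ι} {n : ℕ} {f : C(ι → G, ℝ)}
    (hf : f ∈ wordSpace r (S : Set ι) n) :
    ∫ U, f U ∂(haarPi ι G) =
      ∫ y, f (Function.updateFinset (1 : ι → G) S y) ∂(Measure.pi fun _ : ↥S => haarProbability G) := by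
  have hc : Continuous fun y : ↥S → G => f (Function.updateFinset (1 : ι → G) S y) :=
    f.continuous.comp (continuous_updateFinset_one S)
  rw [haarPi, ← integral_restrict_infinitePi (μ := fun _ : ι => haarProbability G) hc.aestronglyMeasurable]
  exact integral_congr_ae (ae_of_all _ fun U => (apply_updateFinset_restrict_of_mem_wordSpace r hf U).symm)

variable [T2Space G] {K : Type*} {k : K → ℝ → G}
  {X : K → Matrix (Fin r.N) (Fin r.N) ℂ}

/-- ★ **The product Haar state satisfies the Schwinger–Dyson rows at `β = 0`**: for every polynomial
observable `f`, `∫ D_{i,a} f d(haarPi) = 0` (finite marginal + the finite-product theorem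
`eq_pi_tilted_iff_sd` at `β = 0`). [folklore] -/
theorem integral_sderiv_haarPi_eq_zero (hkc : ∀ a, Continuous (k a))
    (hk : ∀ a s t, k a (s + t) = k a s * k a t) (hX : ∀ a t, r.ρ (k a t) = exp ((t : ℂ) • X a))
    (hexh : ∀ g : G, ∃ a t, k a t = g) (i : ι) (a : K) {f : C(ι → G, ℝ)}
    (hf : f ∈ polyAlgebra (ι := ι) r) : ∫ U, sderiv k i a f U ∂(haarPi ι G) = 0 := by
  classical
  -- a finite link set carrying `f` and `i`
  obtain ⟨n, hn⟩ := (eventually_mem_wordTruncation r hf).exists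
  obtain ⟨S₀, hS₀, hfS₀⟩ := exists_finite_mem_wordSpace_of_mem_wordTruncation r hn
  set S : Finset ι := insert i hS₀.toFinset with hS
  have hiS : i ∈ S := Finset.mem_insert_self _ _
  have hfS : f ∈ wordSpace r (S : Set ι) n :=
    wordSpace_mono r (fun j hj => by
      rw [hS, Finset.coe_insert, Set.Finite.coe_toFinset]
      exact Set.mem_insert_of_mem _ hj) le_rfl hfS₀
  have hDf : sderiv k i a f ∈ wordSpace r (S : Set ι) n := sderiv_mem_wordSpace hk hX i a hfS
  rw [integral_haarPi_eq_of_mem_wordSpace r hDf]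
  -- the finite product is a Schwinger–Dyson state at `β = 0` (zero action)
  have hsd : IsSchwingerDysonState k (fun _ : ↥S => fun _ : ↥S → G => (0 : ℝ)) 0
      (Measure.pi fun _ : ↥S => haarProbability G) := by
    have h := (eq_pi_tilted_iff_sd (ι := ↥S) hkc hk hexh (S := fun _ : ↥S → G => (0 : ℝ))
      continuous_const (fun j b => ⟨fun _ => 0, continuous_const, fun U => by
        simpa using hasDerivAt_const (0 : ℝ) (0 : ℝ)⟩) 0
      (Measure.pi fun _ : ↥S => haarProbability G)).1
    apply h
    have h0 : (fun U : ↥S → G => -(0 : ℝ) * (0 : ℝ)) = fun _ => 0 := funext fun _ => by ring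
    rw [h0, tilted_const]
  obtain ⟨S', -, -, hrows⟩ := hsd ⟨i, hiS⟩ a
  have hfA := mem_polyAlgebra_of_mem_wordSpace r hfS
  have hderiv : ∀ y : ↥S → G, HasDerivAt
      (fun t => f (Function.updateFinset (1 : ι → G) S
        (Function.update y ⟨i, hiS⟩ (k a t * y ⟨i, hiS⟩))))
      (sderiv k i a f (Function.updateFinset (1 : ι → G) S y)) 0 := fun y => by
    have h := hasShiftDeriv_sderiv_of_mem_polyAlgebra hk hX i a hfA (Function.updateFinset (1 : ι → G) S y)
    have hy : Function.updateFinset (1 : ι → G) S y i = y ⟨i, hiS⟩ := by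
      simp [Function.updateFinset, hiS]
    simpa only [updateFinset_update y hiS, hy] using h
  have h := hrows (fun y => f (Function.updateFinset (1 : ι → G) S y))
    (fun y => sderiv k i a f (Function.updateFinset (1 : ι → G) S y))
    (f.continuous.comp (continuous_updateFinset_one S))
    ((sderiv k i a f).continuous.comp (continuous_updateFinset_one S)) hderiv
  simpa using h

omit [T2Space G] in
/-- ★ **The product Haar state is faithful on polynomial observables**: `∫ f² d(haarPi) = 0 ⇒ f = 0`
(reduce to the finite product, which charges every open set). [folklore] -/
theorem eq_zero_of_integral_mul_self_haarPi_eq_zero {f : C(ι → G, ℝ)}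
    (hf : f ∈ polyAlgebra (ι := ι) r) (h : ∫ U, (f * f) U ∂(haarPi ι G) = 0) : f = 0 := by
  classical
  obtain ⟨n, hn⟩ := (eventually_mem_wordTruncation r hf).exists
  obtain ⟨S₀, hS₀, hfS₀⟩ := exists_finite_mem_wordSpace_of_mem_wordTruncation r hn
  set S : Finset ι := hS₀.toFinset with hS
  have hfS : f ∈ wordSpace r (S : Set ι) n :=
    wordSpace_mono r (fun j hj => by rw [hS, Set.Finite.coe_toFinset]; exact hj) le_rfl hfS₀
  have hff : f * f ∈ wordSpace r (S : Set ι) (n + n) := mul_mem_wordSpace r hfS hfS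
  rw [integral_haarPi_eq_of_mem_wordSpace r hff] at h
  haveI : (haarProbability G).IsOpenPosMeasure := by unfold haarProbability; infer_instance
  set g : (↥S → G) → ℝ := fun y => f (Function.updateFinset (1 : ι → G) S y) with hg
  have hc : Continuous g := f.continuous.comp (continuous_updateFinset_one S)
  have hcc : Continuous fun y => g y * g y := hc.mul hc
  have hae := (integral_eq_zero_iff_of_nonneg (fun y => mul_self_nonneg (g y))
    (integrable_of_continuous_compact hcc _)).1 (by simpa only [ContinuousMap.mul_apply, hg] using h)
  have hz : (fun y => g y * g y) = fun _ => 0 :=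
    (Continuous.ae_eq_iff_eq (Measure.pi fun _ : ↥S => haarProbability G) hcc continuous_const).1 hae
  ext U
  have hU := congrFun hz (S.restrict U)
  simp only [hg, apply_updateFinset_restrict_of_mem_wordSpace r hfS U, mul_self_eq_zero] at hU
  simpa using hU

end HaarPi

/-! ## `ℤ^d`: the boundary Wilson actions as word observables -/

section Zd

variable {d : ℕ} {G : Type*} [Group G] [TopologicalSpace G] (r : LatticeRep G)

/-- The links of the plaquettes through `e`. -/
def linksAround (e : ZdEdge d) : Finset (ZdEdge d) := (plaquettesTouching {e}).biUnion plaquetteEdges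

/-- **The boundary Wilson action `S_{e}` is a word function of degree `4` on the links of the
plaquettes through `e`.** -/
theorem wilsonBoundaryAction_mem_wordFunctions (e : ZdEdge d) :
    wilsonBoundaryAction r.ρ {e} ∈ wordFunctions r ((linksAround e : Finset (ZdEdge d)) : Set (ZdEdge d)) 4 := by
  have h : wilsonBoundaryAction (G := G) r.ρ {e} = ∑ p ∈ plaquettesTouching {e},
      fun U => ((r.N : ℝ) - (r.ρ (U (p.1, p.2.1.1) * U (p.1 + Pi.single p.2.1.1 1, p.2.1.2) *
        (U (p.1 + Pi.single p.2.1.2 1, p.2.1.1))⁻¹ * (U (p.1, p.2.1.2))⁻¹)).trace.re) := by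
    funext U
    simp only [wilsonBoundaryAction, Finset.sum_apply, plaquetteObs, plaquetteHolonomyZd]
  rw [h]
  refine Submodule.sum_mem _ fun p hp => const_sub_reTrace_word₄_mem_wordFunctions r ?_ ?_ ?_ ?_ _ <;>
    · rw [Finset.mem_coe, linksAround, Finset.mem_biUnion]
      exact ⟨p, hp, by simp [plaquetteEdges]⟩

/-- The boundary Wilson action `S_{e}` as a continuous observable. -/
def zdActionCM (e : ZdEdge d) : C(LGConfig d G, ℝ) :=
  ⟨wilsonBoundaryAction r.ρ {e},
    continuous_of_mem_polyFunctions r (wilsonBoundaryAction_mem_polyFunctions r {e})⟩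

/-- `zdActionCM` is the boundary action. -/
@[simp] theorem coe_zdActionCM (e : ZdEdge d) : ⇑(zdActionCM r e) = wilsonBoundaryAction r.ρ {e} := rfl

/-- It lies in the degree-`4` word space on `linksAround e`. -/
theorem zdActionCM_mem_wordSpace (e : ZdEdge d) :
    zdActionCM r e ∈ wordSpace r ((linksAround e : Finset (ZdEdge d)) : Set (ZdEdge d)) 4 := by
  rw [← coe_mem_wordFunctions_iff, coe_zdActionCM]
  exact wilsonBoundaryAction_mem_wordFunctions r e

variable {K : Type*} (k : K → ℝ → G)

/-- **The shift derivatives of the boundary actions** (the `S'` of the `ℤ^d` rows). -/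
def zdActionDeriv (e : ZdEdge d) (a : K) : C(LGConfig d G, ℝ) := sderiv k e a (zdActionCM r e)

variable {k} {X : K → Matrix (Fin r.N) (Fin r.N) ℂ}

/-- They are word observables of degree `4` on `linksAround e`. -/
theorem zdActionDeriv_mem [ContinuousMul G] (hk : ∀ a s t, k a (s + t) = k a s * k a t)
    (hX : ∀ a t, r.ρ (k a t) = exp ((t : ℂ) • X a)) (e : ZdEdge d) (a : K) :
    zdActionDeriv r k e a ∈ wordSpace r ((linksAround e : Finset (ZdEdge d)) : Set (ZdEdge d)) 4 :=
  sderiv_mem_wordSpace hk hX e a (zdActionCM_mem_wordSpace r e)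

/-- They are the derivatives of the boundary actions along the shifts. -/
theorem hasDerivAt_zdActionDeriv [ContinuousMul G] (hk : ∀ a s t, k a (s + t) = k a s * k a t)
    (hX : ∀ a t, r.ρ (k a t) = exp ((t : ℂ) • X a)) (e : ZdEdge d) (a : K) (U : LGConfig d G) :
    HasDerivAt (fun t => wilsonBoundaryAction r.ρ {e} (Function.update U e (k a t * U e)))
      (zdActionDeriv r k e a U) 0 :=
  hasShiftDeriv_sderiv_of_mem_polyAlgebra hk hX e a
    (mem_polyAlgebra_of_mem_wordSpace r (zdActionCM_mem_wordSpace r e)) U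

end Zd

/-! ## `SU(N)` on `ℤ^d` -/

section SUN

variable {d : ℕ} (N : ℕ)

/-- ★★★ **`SU(N)` on `ℤ^d`: any two level-`M` feasible values of the infinite-volume word-truncated
bootstrap for a length-`n` test function differ by `O(|β|^q)`.** [folklore mechanism; truncated
statement new] -/
theorem exists_const_abs_sub_le_pow_zd_suN {n : ℕ}
    {P : C(LGConfig d (Matrix.specialUnitaryGroup (Fin N) ℂ), ℝ)}
    (hP : P ∈ wordTruncation (ι := ZdEdge d) (fundamentalLatticeRep N) n) (q : ℕ) :
    ∃ C : ℝ, 0 ≤ C ∧ ∀ (M : ℕ), n + 4 * q ≤ M + 4 → n + 4 * q ≤ 2 * M → ∀ (β : ℝ)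
      (φ ψ : C(LGConfig d (Matrix.specialUnitaryGroup (Fin N) ℂ), ℝ) →ₗ[ℝ] ℝ),
      IsBootstrapFeasible (fundamentalLatticeRep N) (suExp N)
        (fun e => wilsonBoundaryAction (fundamentalRep (Fin N)) {e}) β
        (wordTruncation (ι := ZdEdge d) (fundamentalLatticeRep N) M) φ →
      IsBootstrapFeasible (fundamentalLatticeRep N) (suExp N)
        (fun e => wilsonBoundaryAction (fundamentalRep (Fin N)) {e}) β
        (wordTruncation (ι := ZdEdge d) (fundamentalLatticeRep N) M) ψ →
      |φ P - ψ P| ≤ C * |β| ^ q := by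
  classical
  obtain ⟨S₀, hS₀, hPS₀⟩ := exists_finite_mem_wordSpace_of_mem_wordTruncation _ hP
  have hP' : P ∈ wordSpace (fundamentalLatticeRep N) ((hS₀.toFinset : Finset (ZdEdge d)) : Set (ZdEdge d)) n :=
    wordSpace_mono _ (fun j hj => by rw [Set.Finite.coe_toFinset]; exact hj) le_rfl hPS₀
  exact exists_const_abs_sub_le_pow (r := fundamentalLatticeRep N) (suExp_add N)
    (X := fun X : SuGenerator N => (X : Matrix (Fin N) (Fin N) ℂ)) (rho_suExp N)
    (fun g => exists_suExp_eq N g) (suGen N) (suGen_span N)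
    (φ₀ := expectationFunctional (haarPi (ZdEdge d) (Matrix.specialUnitaryGroup (Fin N) ℂ)))
    (fun i a f hf => by
      rw [expectationFunctional_apply]
      exact integral_sderiv_haarPi_eq_zero (fundamentalLatticeRep N) (continuous_suExp N) (suExp_add N)
        (rho_suExp N) (fun g => exists_suExp_eq N g) i a hf)
    (fun f _ => expectationFunctional_sq_nonneg _ f)
    (fun f hf h => eq_zero_of_integral_mul_self_haarPi_eq_zero (fundamentalLatticeRep N) hf h)
    (T := linksAround) (zdActionDeriv_mem (fundamentalLatticeRep N) (suExp_add N) (rho_suExp N))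
    (Sact := fun e => wilsonBoundaryAction (fundamentalRep (Fin N)) {e})
    (hasDerivAt_zdActionDeriv (fundamentalLatticeRep N) (suExp_add N) (rho_suExp N))
    q hS₀.toFinset n hP'

/-- ★★★ **`SU(N)` on `ℤ^d`, `β = 0`: the level-`M` infinite-volume bootstrap is EXACT on test
functions of length `≤ M`** — every feasible functional (indeed the rows alone matter) gives them
their product-Haar value. [folklore] -/
theorem apply_eq_haarPi_of_feasible_zero_zd_suN {n M : ℕ} (hnM : n ≤ M)
    {P : C(LGConfig d (Matrix.specialUnitaryGroup (Fin N) ℂ), ℝ)}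
    (hP : P ∈ wordTruncation (ι := ZdEdge d) (fundamentalLatticeRep N) n)
    {φ : C(LGConfig d (Matrix.specialUnitaryGroup (Fin N) ℂ), ℝ) →ₗ[ℝ] ℝ}
    (hφ : IsBootstrapFeasible (fundamentalLatticeRep N) (suExp N)
      (fun e => wilsonBoundaryAction (fundamentalRep (Fin N)) {e}) 0
      (wordTruncation (ι := ZdEdge d) (fundamentalLatticeRep N) M) φ) :
    φ P = ∫ U, P U ∂(haarPi (ZdEdge d) (Matrix.specialUnitaryGroup (Fin N) ℂ)) := by
  classical
  obtain ⟨S₀, hS₀, hPS₀⟩ := exists_finite_mem_wordSpace_of_mem_wordTruncation _ (wordTruncation_mono _ hnM hP)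
  have hP' : P ∈ wordSpace (fundamentalLatticeRep N) ((hS₀.toFinset : Finset (ZdEdge d)) : Set (ZdEdge d)) M :=
    wordSpace_mono _ (fun j hj => by rw [Set.Finite.coe_toFinset]; exact hj) le_rfl hPS₀
  have h := IsBootstrapFeasible.apply_eq_of_zero (r := fundamentalLatticeRep N) (suExp_add N)
    (X := fun X : SuGenerator N => (X : Matrix (Fin N) (Fin N) ℂ)) (rho_suExp N)
    (fun g => exists_suExp_eq N g) (suGen N) (suGen_span N)
    (φ₀ := expectationFunctional (haarPi (ZdEdge d) (Matrix.specialUnitaryGroup (Fin N) ℂ)))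
    (fun i a f hf => by
      rw [expectationFunctional_apply]
      exact integral_sderiv_haarPi_eq_zero (fundamentalLatticeRep N) (continuous_suExp N) (suExp_add N)
        (rho_suExp N) (fun g => exists_suExp_eq N g) i a hf)
    (fun f _ => expectationFunctional_sq_nonneg _ f)
    (fun f hf h => eq_zero_of_integral_mul_self_haarPi_eq_zero (fundamentalLatticeRep N) hf h)
    (Sact := fun e => wilsonBoundaryAction (fundamentalRep (Fin N)) {e})
    (hasDerivAt_zdActionDeriv (fundamentalLatticeRep N) (suExp_add N) (rho_suExp N))
    hS₀.toFinset M hφ hP'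
  rw [h, expectationFunctional_one, div_one, expectationFunctional_apply]

/-- ★★ **Every DLR state is feasible at every level**, so the level-`M` interval above contains every
infinite-volume (DLR) expectation of `P` at coupling `β`. [folklore] -/
theorem dlr_mem_feasible_zd_suN (β : ℝ) {μ : Measure (LGConfig d (Matrix.specialUnitaryGroup (Fin N) ℂ))}
    [IsProbabilityMeasure μ] (hμ : μ ∈ ymGibbsMeasures (d := d) (fundamentalRep (Fin N)) β) (M : ℕ) :
    IsBootstrapFeasible (fundamentalLatticeRep N) (suExp N)
      (fun e => wilsonBoundaryAction (fundamentalRep (Fin N)) {e}) β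
      (wordTruncation (ι := ZdEdge d) (fundamentalLatticeRep N) M) (expectationFunctional μ) :=
  isBootstrapFeasible_dlr_suN N β hμ (wordTruncation_subset_polyAlgebra _ M)

end SUN

end Summit.QuantumFields.GaugeBoot

end
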